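import Summits.BirchSwinnertonDyer.BirchSwinnertonDyer.Theorems.Rank2ObservatoryThreeIsoLocalKillEhat
import Summits.BirchSwinnertonDyer.BirchSwinnertonDyer.Theorems.Rank2ObservatoryThreeIsoCertE
import Summits.BirchSwinnertonDyer.BirchSwinnertonDyer.Theorems.Rank2ObservatoryThreeIsoKField
import Summits.BirchSwinnertonDyer.BirchSwinnertonDyer.Theorems.Rank2ObservatoryThreeIsoPrimes

/-!
# Rank-2 observatory, KERNEL-3ISO (B4-3): the `Ê`-side image bound from a certificate list

HONEST FRAMING: per-curve certified theorems and census instruments; no claim on BSD in rank ≥ 2.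

Cell `bsd-rank2-observatory`, cert-1 leg KERNEL-3ISO, generation 10. Over `K = ℚ(ζ₃)`
(`η = ζ₃`, `θ = 2ζ + 1`) the row's support law (B3b, `exists_descentEhat_class` + norm cut) leaves
the classes `ε_w = ζ^j ∏_ℓ π_ℓ^{i_ℓ} π̄_ℓ^{(3-i_ℓ) mod 3}`, `w = (j, i) ∈ 𝔽₃ × 𝔽₃^t`, of the split
primes `π_ℓ = a_ℓ + b_ℓη`, `π̄_ℓ = (a_ℓ - b_ℓ) - b_ℓη` (integer coordinates `πs, πc : Fin t → ℤ × ℤ`,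
hypothesis `hsupp`). A LOCAL-KILL CERTIFICATE `((w, p, k), (g, l₁, l₂, l₃), (x, y, n), (C₁, …, C₇))`
records the class `w`, the integer coordinates `ε_w = x + yη` — CHECKED against `w` by an integer
fold of the coordinate products (`(a + bη)(c + dη) = (ac - bd) + (ad + bc - bd)η`) — so that
`2ε_w = e₁ + e₂θ` with `e₁ = 2x - y`, `e₂ = y`, the norm `e₁² + 3e₂² = 4n³`, and the `p`-minimised
torsor `Σ Cᵢ Mᵢ = (1/g)·F(l₁ r, l₂ t, l₃ v)` of `F = e₂ R + e₁ T + 6mn(r² + 3t²)v + 2(81s - 12m³)v³`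
(B4-1 `ThreeIso.ehat_descent_value_ne_of_kill`) with its three affine charts empty modulo `p^k`;
validity is a `decide`-able conjunction over `ℕ`/`ℤ` (`hvalid`, one `decide` per row).
**`ehat_descent_mem_of_certs`**: every value `κ'(Q)` lies in the image of the indices `w` killed by
no certificate, directly or through the inverse index `w + w` (`κ'(-Q) = -κ'(Q)`; the two classes
multiply to a cube). No definitions: the fold is an inline `List.foldl` of iterated coordinate
multiplications (`coordsK_foldl`, `coordsK_iterate_mul`).

References: [Cohen2007NumberTheoryI] H. Cohen, GTM 239, Prop. 8.4.8, §8.4.5; [CohenPazuki2009]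
H. Cohen, F. Pazuki, Acta Arith. 140 (2009), Prop. 2.2, Thm. 3.1.
-/

set_option linter.dupNamespace false

noncomputable section

open scoped Classical

open WeierstrassCurve NumberField

namespace Summit.BirchSwinnertonDyer.BirchSwinnertonDyer.Rank2Observatory.ThreeIso

open Literature.NumberTheory.EllipticCurves Literature.NumberTheory.EllipticCurves.MordellDescent

variable {K : Type*} [Field K] [NumberField K] [IsCyclotomicExtension {3} ℚ K] {ζ : K}
  (hζ : IsPrimitiveRoot ζ 3)

omit [NumberField K] [IsCyclotomicExtension {3} ℚ K] in
/-- `(a + bη : 𝓞 K) = a + bζ` in `K`. [folklore] -/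
theorem coe_int_coords (a b : ℤ) :
    ((((a : 𝓞 K) + (b : ℤ) * hζ.toInteger : 𝓞 K)) : K) = (a : K) + (b : K) * ζ := by
  change algebraMap (𝓞 K) K _ = _
  rw [map_add, map_mul, map_intCast, map_intCast]
  rfl

omit [NumberField K] [IsCyclotomicExtension {3} ℚ K] in
include hζ in
/-- Iterated coordinate multiplication by `y = (c, d)`:
`(a + bζ)(c + dζ) = (ac - bd) + (ad + bc - bd)ζ`. [folklore] -/
theorem coordsK_iterate_mul (y x : ℤ × ℤ) (i : ℕ) :
    ((((fun z : ℤ × ℤ => (z.1 * (y).1 - z.2 * (y).2, z.1 * (y).2 + z.2 * (y).1 - z.2 * (y).2))^[i]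
        x).1 : K) + (((fun z : ℤ × ℤ => (z.1 * (y).1 - z.2 * (y).2, z.1 * (y).2 + z.2 * (y).1 - z.2
        * (y).2))^[i] x).2 : K) * ζ)
      = (((x).1 : K) + ((x).2 : K) * ζ) * (((y).1 : K) + ((y).2 : K) * ζ) ^ i := by
  induction i with
  | zero => simp
  | succ i ih =>
    rw [Function.iterate_succ_apply', pow_succ, ← mul_assoc, ← ih]
    push_cast
    linear_combination (-((((fun z : ℤ × ℤ => (z.1 * (y).1 - z.2 * (y).2, z.1 * (y).2 + z.2 * (y).1
        - z.2 * (y).2))^[i] x).2 : K)) * (y.2 : K)) * zeta_sq_add_zeta_add_one hζ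

omit [NumberField K] [IsCyclotomicExtension {3} ℚ K] in
include hζ in
/-- Iterated multiplication by `ζ` from `1`: coordinates of `ζ^j`. [folklore] -/
theorem coordsK_iterate_zeta (j : ℕ) :
    ((((fun z : ℤ × ℤ => (-z.2, z.1 - z.2))^[j] ((1 : ℤ), (0 : ℤ))).1 : K) + (((fun z : ℤ × ℤ =>
        (-z.2, z.1 - z.2))^[j] ((1 : ℤ), (0 : ℤ))).2 : K) * ζ) = ζ ^ j := by
  induction j with
  | zero => simp
  | succ j ih =>
    rw [Function.iterate_succ_apply', pow_succ, ← ih]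
    push_cast
    linear_combination (-((((fun z : ℤ × ℤ => (-z.2, z.1 - z.2))^[j] ((1 : ℤ), (0 : ℤ))).2 : K)))
      * zeta_sq_add_zeta_add_one hζ

omit [NumberField K] [IsCyclotomicExtension {3} ℚ K] in
/-- A left fold of coordinate steps, each multiplying by `g d` in `K`, multiplies by `∏ g d`.
[folklore] -/
theorem coordsK_foldl {D : Type*} (L : List D) (f : ℤ × ℤ → D → ℤ × ℤ) (g : D → K)
    (hf : ∀ x, ∀ d ∈ L, (((f x d).1 : K) + ((f x d).2 : K) * ζ) = (((x).1 : K) + ((x).2 : K) * ζ) *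
        g d) (acc : ℤ × ℤ) :
    (((L.foldl f acc).1 : K) + ((L.foldl f acc).2 : K) * ζ) = (((acc).1 : K) + ((acc).2 : K) * ζ) *
        (L.map g).prod := by
  induction L generalizing acc with
  | nil => simp
  | cons d L ih =>
    rw [List.foldl_cons, List.map_cons, List.prod_cons,
      ih (fun x d' hd' => hf x d' (List.mem_cons_of_mem _ hd')) (f acc d),
      hf acc d (List.mem_cons_self ..), mul_assoc]

/-- **`Ê`-side image bound from a certificate list** (B3b support law as hypothesis `hsupp` + B4-1
local kills, read from validated data). For `Ê_{m,s}` (`m, s ∈ ℤ`) with split-prime coordinates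
`πs, πc : Fin t → ℤ × ℤ` and a list of valid local-kill certificates, every value of the `3`-descent
map `κ'` over `K = ℚ(ζ₃)` is `[ζ^j ∏ π_ℓ^{i_ℓ} π̄_ℓ^{(3-i_ℓ) mod 3}]` for an index `w = (j, i)` which no
certificate kills directly or through `w + w`.
[cite: Cohen2007NumberTheoryI, Prop. 8.4.8; CohenPazuki2009, Prop. 2.2, Thm. 3.1] -/
theorem ehat_descent_mem_of_certs {m s : ℤ} {W W' : WeierstrassCurve ℚ}
    (h : IsVeluThreePair (m : ℚ) (s : ℚ) W W')
    (κ' : W'.toAffine.Point →+ Additive (CubeUnits K))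
    (hκ' : ∀ (X Y : ℚ) (hQ : W'.toAffine.Nonsingular X Y), κ' (.some X Y hQ) =
      Additive.ofMul (cubeClass ((Y : K) - (2 * ζ + 1) * (((m : ℚ) : K) * ((X : K) + 4 * ((m : ℚ)
          : K) ^ 2 / 3)
          + (27 * ((s : ℚ) : K) - 4 * ((m : ℚ) : K) ^ 3) / 9))))
    {t : ℕ} (πs πc : Fin t → ℤ × ℤ) (hπ0 : ∀ ℓ, πs ℓ ≠ 0 ∧ πc ℓ ≠ 0)
    (hsupp : ∀ (X Y : ℚ) (hQ : W'.toAffine.Nonsingular X Y), ∃ w : Fin 3 × (Fin t → Fin 3),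
      cubeClass ((Y : K) - (2 * ζ + 1) * (((m : ℚ) : K) * ((X : K) + 4 * ((m : ℚ) : K) ^ 2 / 3)
          + (27 * ((s : ℚ) : K) - 4 * ((m : ℚ) : K) ^ 3) / 9)) =
        cubeClass (ζ ^ ((w).1 : ℕ) * ∏ ℓ : Fin t, (((((πs ℓ).1 : 𝓞 K) + ((πs ℓ).2 : ℤ) *
            hζ.toInteger : 𝓞 K) : K) ^ (((w).2 ℓ : Fin 3) : ℕ)
        * ((((πc ℓ).1 : 𝓞 K) + ((πc ℓ).2 : ℤ) * hζ.toInteger : 𝓞 K) : K) ^ ((3 - (((w).2 ℓ : Fin 3)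
            : ℕ)) % 3))))
    (certs : List (((Fin 3 × (Fin t → Fin 3)) × ℕ × ℕ) × (ℕ × ℕ × ℕ × ℕ) × (ℤ × ℤ × ℤ) × (ℤ × ℤ × ℤ
        × ℤ × ℤ × ℤ × ℤ)))
    (hvalid : ∀ c ∈ certs,
      c.1.2.1.Prime ∧ c.1.1 ≠ 0 ∧ 0 < c.2.1.1 ∧ 0 < c.2.1.2.1 ∧ 0 < c.2.1.2.2.1 ∧ 0 < c.2.1.2.2.2 ∧
          c.2.2.1.2.2 ≠ 0 ∧
      (2 * c.2.2.1.1 - c.2.2.1.2.1) ^ 2 + 3 * c.2.2.1.2.1 ^ 2 = 4 * c.2.2.1.2.2 ^ 3 ∧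
      ((List.ofFn fun ℓ : Fin t => (πs ℓ, πc ℓ, (((c.1.1).2 ℓ : Fin 3) : ℕ))).foldl
        (fun (x : ℤ × ℤ) (d : (ℤ × ℤ) × (ℤ × ℤ) × ℕ) =>
          (fun z : ℤ × ℤ => (z.1 * (d.2.1).1 - z.2 * (d.2.1).2, z.1 * (d.2.1).2 + z.2 * (d.2.1).1
              - z.2 * (d.2.1).2))^[(3 - d.2.2) % 3]
            ((fun z : ℤ × ℤ => (z.1 * (d.1).1 - z.2 * (d.1).2, z.1 * (d.1).2 + z.2 * (d.1).1 - z.2 *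
                (d.1).2))^[d.2.2] x))
        ((fun z : ℤ × ℤ => (-z.2, z.1 - z.2))^[((c.1.1).1 : ℕ)] ((1 : ℤ), (0 : ℤ)))) = (c.2.2.1.1,
            c.2.2.1.2.1) ∧
      c.2.2.2.1 * c.2.1.1 = c.2.2.1.2.1 * (c.2.1.2.1 : ℤ) ^ 3 ∧
      c.2.2.2.2.1 * c.2.1.1 = 3 * (2 * c.2.2.1.1 - c.2.2.1.2.1) * ((c.2.1.2.1 : ℤ) ^ 2 *
          c.2.1.2.2.1) ∧
      c.2.2.2.2.2.1 * c.2.1.1 = -9 * c.2.2.1.2.1 * ((c.2.1.2.1 : ℤ) * c.2.1.2.2.1 ^ 2) ∧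
      c.2.2.2.2.2.2.1 * c.2.1.1 = -3 * (2 * c.2.2.1.1 - c.2.2.1.2.1) * (c.2.1.2.2.1 : ℤ) ^ 3 ∧
      c.2.2.2.2.2.2.2.1 * c.2.1.1 = 6 * m * c.2.2.1.2.2 * ((c.2.1.2.1 : ℤ) ^ 2 * c.2.1.2.2.2) ∧
      c.2.2.2.2.2.2.2.2.1 * c.2.1.1 = 18 * m * c.2.2.1.2.2 * ((c.2.1.2.2.1 : ℤ) ^ 2 * c.2.1.2.2.2) ∧
      c.2.2.2.2.2.2.2.2.2 * c.2.1.1 = 2 * (81 * s - 12 * m ^ 3) * (c.2.1.2.2.2 : ℤ) ^ 3 ∧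
      (∀ b : ℕ, b < c.1.2.1 ^ c.1.2.2 → ∀ d : ℕ, d < c.1.2.1 ^ c.1.2.2 →
        (c.2.2.2.1 * 1 ^ 3 + c.2.2.2.2.1 * (1 ^ 2 * (b : ℤ)) + c.2.2.2.2.2.1 * (1 * (b : ℤ) ^ 2) +
            c.2.2.2.2.2.2.1 * (b : ℤ) ^ 3
          + c.2.2.2.2.2.2.2.1 * (1 ^ 2 * (d : ℤ)) + c.2.2.2.2.2.2.2.2.1 * ((b : ℤ) ^ 2 * d) +
              c.2.2.2.2.2.2.2.2.2 * (d : ℤ) ^ 3) % ((c.1.2.1 ^ c.1.2.2 : ℕ) : ℤ) ≠ 0) ∧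
      (∀ a : ℕ, a < c.1.2.1 ^ c.1.2.2 → ∀ d : ℕ, d < c.1.2.1 ^ c.1.2.2 →
        (c.2.2.2.1 * (a : ℤ) ^ 3 + c.2.2.2.2.1 * ((a : ℤ) ^ 2 * 1) + c.2.2.2.2.2.1 * ((a : ℤ) * 1 ^
            2) + c.2.2.2.2.2.2.1 * 1 ^ 3
          + c.2.2.2.2.2.2.2.1 * ((a : ℤ) ^ 2 * d) + c.2.2.2.2.2.2.2.2.1 * (1 ^ 2 * (d : ℤ)) +
              c.2.2.2.2.2.2.2.2.2 * (d : ℤ) ^ 3) % ((c.1.2.1 ^ c.1.2.2 : ℕ) : ℤ) ≠ 0) ∧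
      (∀ a : ℕ, a < c.1.2.1 ^ c.1.2.2 → ∀ b : ℕ, b < c.1.2.1 ^ c.1.2.2 →
        (c.2.2.2.1 * (a : ℤ) ^ 3 + c.2.2.2.2.1 * ((a : ℤ) ^ 2 * b) + c.2.2.2.2.2.1 * ((a : ℤ) * (b
            : ℤ) ^ 2) + c.2.2.2.2.2.2.1 * (b : ℤ) ^ 3
          + c.2.2.2.2.2.2.2.1 * ((a : ℤ) ^ 2 * 1) + c.2.2.2.2.2.2.2.2.1 * ((b : ℤ) ^ 2 * 1) +
              c.2.2.2.2.2.2.2.2.2 * 1 ^ 3) % ((c.1.2.1 ^ c.1.2.2 : ℕ) : ℤ) ≠ 0))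
    (Q : W'.toAffine.Point) :
    κ' Q ∈ ((Finset.univ : Finset (Fin 3 × (Fin t → Fin 3))).filter
        (fun w => ∀ c ∈ certs, c.1.1 ≠ w ∧ c.1.1 ≠ w + w)).image
      (fun w => Additive.ofMul (cubeClass (ζ ^ ((w).1 : ℕ) * ∏ ℓ : Fin t, (((((πs ℓ).1 : 𝓞 K) + ((πs
          ℓ).2 : ℤ) * hζ.toInteger : 𝓞 K) : K) ^ (((w).2 ℓ : Fin 3) : ℕ)
        * ((((πc ℓ).1 : 𝓞 K) + ((πc ℓ).2 : ℤ) * hζ.toInteger : 𝓞 K) : K) ^ ((3 - (((w).2 ℓ : Fin 3)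
            : ℕ)) % 3))))) := by
  have hθ := theta_sq_eq hζ
  have hK := exists_rat_coords_theta hζ
  have hζ0 : ζ ≠ 0 := hζ.ne_zero (by norm_num)
  -- coordinates → elements of `K`
  have hEK : ∀ w : Fin 3 × (Fin t → Fin 3), (ζ ^ ((w).1 : ℕ) * ∏ ℓ : Fin t, (((((πs ℓ).1 : 𝓞 K) +
      ((πs ℓ).2 : ℤ) * hζ.toInteger : 𝓞 K) : K) ^ (((w).2 ℓ : Fin 3) : ℕ)
        * ((((πc ℓ).1 : 𝓞 K) + ((πc ℓ).2 : ℤ) * hζ.toInteger : 𝓞 K) : K) ^ ((3 - (((w).2 ℓ : Fin 3)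
            : ℕ)) % 3)))
      = (ζ ^ ((w).1 : ℕ) * ∏ ℓ : Fin t, ((((πs ℓ).1 : K) + ((πs ℓ).2 : K) * ζ) ^ (((w).2 ℓ : Fin 3)
          : ℕ)
        * (((πc ℓ).1 : K) + ((πc ℓ).2 : K) * ζ) ^ ((3 - (((w).2 ℓ : Fin 3) : ℕ)) % 3))) := fun w =>
            by
    simp_rw [coe_int_coords hζ]
  have helt0 : ∀ x : ℤ × ℤ, x ≠ 0 → (((x).1 : K) + ((x).2 : K) * ζ) ≠ 0 := by
    intro x hx h0
    rw [← coe_int_coords hζ] at h0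
    obtain ⟨h1, h2⟩ := int_coords_eq_zero hζ (RingOfIntegers.coe_eq_zero_iff.mp h0)
    exact hx (Prod.ext h1 h2)
  have hE0 : ∀ w : Fin 3 × (Fin t → Fin 3), (ζ ^ ((w).1 : ℕ) * ∏ ℓ : Fin t, ((((πs ℓ).1 : K) + ((πs
      ℓ).2 : K) * ζ) ^ (((w).2 ℓ : Fin 3) : ℕ)
        * (((πc ℓ).1 : K) + ((πc ℓ).2 : K) * ζ) ^ ((3 - (((w).2 ℓ : Fin 3) : ℕ)) % 3))) ≠ 0 := fun w
            =>
    mul_ne_zero (pow_ne_zero _ hζ0) (Finset.prod_ne_zero_iff.mpr fun ℓ _ =>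
      mul_ne_zero (pow_ne_zero _ (helt0 _ (hπ0 ℓ).1)) (pow_ne_zero _ (helt0 _ (hπ0 ℓ).2)))
  -- the inverse index: `ε_{w+w} ε_w` is a cube
  have hcube : ∀ w : Fin 3 × (Fin t → Fin 3), (ζ ^ (((w + w)).1 : ℕ) * ∏ ℓ : Fin t, ((((πs ℓ).1 : K)
      + ((πs ℓ).2 : K) * ζ) ^ ((((w + w)).2 ℓ : Fin 3) : ℕ)
        * (((πc ℓ).1 : K) + ((πc ℓ).2 : K) * ζ) ^ ((3 - ((((w + w)).2 ℓ : Fin 3) : ℕ)) % 3))) * (ζ ^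
            ((w).1 : ℕ) * ∏ ℓ : Fin t, ((((πs ℓ).1 : K) + ((πs ℓ).2 : K) * ζ) ^ (((w).2 ℓ : Fin 3)
            : ℕ)
        * (((πc ℓ).1 : K) + ((πc ℓ).2 : K) * ζ) ^ ((3 - (((w).2 ℓ : Fin 3) : ℕ)) % 3)))
      = (ζ ^ (if w.1 = 0 then 0 else 1) * ∏ ℓ : Fin t, ((((πs ℓ).1 : K) + ((πs ℓ).2 : K) * ζ) ^ (if
          w.2 ℓ = 0 then 0 else 1)
          * (((πc ℓ).1 : K) + ((πc ℓ).2 : K) * ζ) ^ (if w.2 ℓ = 0 then 0 else 1))) ^ 3 := by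
    intro w
    simp only [Prod.fst_add, Prod.snd_add, Pi.add_apply]
    rw [mul_mul_mul_comm, ← Finset.prod_mul_distrib, mul_pow, ← Finset.prod_pow,
      ← pow_add_self_mul_pow_eq_cube ζ w.1]
    congr 1
    refine Finset.prod_congr rfl fun ℓ _ => ?_
    rw [mul_pow, ← pow_add_self_mul_pow_eq_cube _ (w.2 ℓ), ← pow_sub_add_self_mul_pow_sub_eq_cube _
        (w.2 ℓ)]
    ring
  -- a valid certificate kills its class at every affine rational point (B4-1)
  have hkill : ∀ c ∈ certs, ∀ (X Y : ℚ) (hQ : W'.toAffine.Nonsingular X Y),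
      cubeClass ((Y : K) - (2 * ζ + 1) * (((m : ℚ) : K) * ((X : K) + 4 * ((m : ℚ) : K) ^ 2 / 3)
          + (27 * ((s : ℚ) : K) - 4 * ((m : ℚ) : K) ^ 3) / 9)) =
        cubeClass (ζ ^ ((c.1.1).1 : ℕ) * ∏ ℓ : Fin t, ((((πs ℓ).1 : K) + ((πs ℓ).2 : K) * ζ) ^
            (((c.1.1).2 ℓ : Fin 3) : ℕ)
        * (((πc ℓ).1 : K) + ((πc ℓ).2 : K) * ζ) ^ ((3 - (((c.1.1).2 ℓ : Fin 3) : ℕ)) % 3))) → False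
            := by
    intro c hc X Y hQ hcl
    obtain ⟨hp, -, hg, hl₁, hl₂, hl₃, hn0, hn, hxy, hC1, hC2, hC3, hC4, hC5, hC6, hC7, hk₁, hk₂,
        hk₃⟩ :=
      hvalid c hc
    haveI : Fact c.1.2.1.Prime := ⟨hp⟩
    haveI : NeZero (c.1.2.1 ^ c.1.2.2) := ⟨pow_ne_zero _ hp.ne_zero⟩
    -- the integer fold computes the coordinates of `ε_w`
    have hfold : (((((List.ofFn fun ℓ : Fin t => (πs ℓ, πc ℓ, (((c.1.1).2 ℓ : Fin 3) : ℕ))).foldl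
        (fun (x : ℤ × ℤ) (d : (ℤ × ℤ) × (ℤ × ℤ) × ℕ) =>
          (fun z : ℤ × ℤ => (z.1 * (d.2.1).1 - z.2 * (d.2.1).2, z.1 * (d.2.1).2 + z.2 * (d.2.1).1
              - z.2 * (d.2.1).2))^[(3 - d.2.2) % 3]
            ((fun z : ℤ × ℤ => (z.1 * (d.1).1 - z.2 * (d.1).2, z.1 * (d.1).2 + z.2 * (d.1).1 - z.2 *
                (d.1).2))^[d.2.2] x))
        ((fun z : ℤ × ℤ => (-z.2, z.1 - z.2))^[((c.1.1).1 : ℕ)] ((1 : ℤ), (0 : ℤ))))).1 : K) +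
            ((((List.ofFn fun ℓ : Fin t => (πs ℓ, πc ℓ, (((c.1.1).2 ℓ : Fin 3) : ℕ))).foldl
        (fun (x : ℤ × ℤ) (d : (ℤ × ℤ) × (ℤ × ℤ) × ℕ) =>
          (fun z : ℤ × ℤ => (z.1 * (d.2.1).1 - z.2 * (d.2.1).2, z.1 * (d.2.1).2 + z.2 * (d.2.1).1
              - z.2 * (d.2.1).2))^[(3 - d.2.2) % 3]
            ((fun z : ℤ × ℤ => (z.1 * (d.1).1 - z.2 * (d.1).2, z.1 * (d.1).2 + z.2 * (d.1).1 - z.2 *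
                (d.1).2))^[d.2.2] x))
        ((fun z : ℤ × ℤ => (-z.2, z.1 - z.2))^[((c.1.1).1 : ℕ)] ((1 : ℤ), (0 : ℤ))))).2 : K) * ζ)
        = (ζ ^ ((c.1.1).1 : ℕ) * ∏ ℓ : Fin t, ((((πs ℓ).1 : K) + ((πs ℓ).2 : K) * ζ) ^ (((c.1.1).2 ℓ
            : Fin 3) : ℕ)
        * (((πc ℓ).1 : K) + ((πc ℓ).2 : K) * ζ) ^ ((3 - (((c.1.1).2 ℓ : Fin 3) : ℕ)) % 3))) := by
      rw [coordsK_foldl (List.ofFn fun ℓ : Fin t => (πs ℓ, πc ℓ, (((c.1.1).2 ℓ : Fin 3) : ℕ)))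
          (fun (x : ℤ × ℤ) (d : (ℤ × ℤ) × (ℤ × ℤ) × ℕ) =>
          (fun z : ℤ × ℤ => (z.1 * (d.2.1).1 - z.2 * (d.2.1).2, z.1 * (d.2.1).2 + z.2 * (d.2.1).1
              - z.2 * (d.2.1).2))^[(3 - d.2.2) % 3]
            ((fun z : ℤ × ℤ => (z.1 * (d.1).1 - z.2 * (d.1).2, z.1 * (d.1).2 + z.2 * (d.1).1 - z.2 *
                (d.1).2))^[d.2.2] x))
          (fun d : (ℤ × ℤ) × (ℤ × ℤ) × ℕ => (((d.1).1 : K) + ((d.1).2 : K) * ζ) ^ d.2.2 *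
              (((d.2.1).1 : K) + ((d.2.1).2 : K) * ζ) ^ ((3 - d.2.2) % 3))
          (fun x d _ => by
            show ((((fun z : ℤ × ℤ => (z.1 * (d.2.1).1 - z.2 * (d.2.1).2, z.1 * (d.2.1).2 + z.2 *
                (d.2.1).1 - z.2 * (d.2.1).2))^[(3 - d.2.2) % 3] ((fun z : ℤ × ℤ => (z.1 * (d.1).1
                - z.2 * (d.1).2, z.1 * (d.1).2 + z.2 * (d.1).1 - z.2 * (d.1).2))^[d.2.2] x)).1 : K)
                + (((fun z : ℤ × ℤ => (z.1 * (d.2.1).1 - z.2 * (d.2.1).2, z.1 * (d.2.1).2 + z.2 *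
                (d.2.1).1 - z.2 * (d.2.1).2))^[(3 - d.2.2) % 3] ((fun z : ℤ × ℤ => (z.1 * (d.1).1
                - z.2 * (d.1).2, z.1 * (d.1).2 + z.2 * (d.1).1 - z.2 * (d.1).2))^[d.2.2] x)).2 : K)
                * ζ) = _
            rw [coordsK_iterate_mul hζ, coordsK_iterate_mul hζ, mul_assoc]),
        coordsK_iterate_zeta hζ, List.map_ofFn, List.prod_ofFn]
      rfl
    have hε : 2 * (ζ ^ ((c.1.1).1 : ℕ) * ∏ ℓ : Fin t, ((((πs ℓ).1 : K) + ((πs ℓ).2 : K) * ζ) ^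
        (((c.1.1).2 ℓ : Fin 3) : ℕ)
        * (((πc ℓ).1 : K) + ((πc ℓ).2 : K) * ζ) ^ ((3 - (((c.1.1).2 ℓ : Fin 3) : ℕ)) % 3)))
        = (((2 * c.2.2.1.1 - c.2.2.1.2.1) : ℤ) : K) + (c.2.2.1.2.1 : K) * (2 * ζ + 1) := by
      rw [← hfold, hxy]; push_cast; ring
    have hgQ : (c.2.1.1 : ℚ) ≠ 0 := by exact_mod_cast hg.ne'
    refine ehat_descent_value_ne_of_kill hθ hK h hQ (Or.inl hε) hn hn0 (c := 1 / (c.2.1.1 : ℚ))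
      (l₁ := c.2.1.2.1) (l₂ := c.2.1.2.2.1) (l₃ := c.2.1.2.2.2) (by exact_mod_cast hl₁.ne') (by
          exact_mod_cast hl₂.ne')
      (C₁ := c.2.2.2.1) (C₂ := c.2.2.2.2.1) (C₃ := c.2.2.2.2.2.1) (C₄ := c.2.2.2.2.2.2.1) (C₅ :=
          c.2.2.2.2.2.2.2.1)
      (C₆ := c.2.2.2.2.2.2.2.2.1) (C₇ := c.2.2.2.2.2.2.2.2.2)
      (by exact_mod_cast hl₃.ne') ?_ ?_ ?_ ?_ ?_ ?_ ?_ (p := c.1.2.1) (k := c.1.2.2) ?_ ?_ ?_ hcl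
    · field_simp; rw [← Int.cast_inj (α := ℚ)] at hC1; push_cast at hC1 ⊢; linear_combination hC1
    · field_simp; rw [← Int.cast_inj (α := ℚ)] at hC2; push_cast at hC2 ⊢; linear_combination hC2
    · field_simp; rw [← Int.cast_inj (α := ℚ)] at hC3; push_cast at hC3 ⊢; linear_combination hC3
    · field_simp; rw [← Int.cast_inj (α := ℚ)] at hC4; push_cast at hC4 ⊢; linear_combination hC4
    · field_simp; rw [← Int.cast_inj (α := ℚ)] at hC5; push_cast at hC5 ⊢; linear_combination hC5
    · field_simp; rw [← Int.cast_inj (α := ℚ)] at hC6; push_cast at hC6 ⊢; linear_combination hC6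
    · field_simp; rw [← Int.cast_inj (α := ℚ)] at hC7; push_cast at hC7 ⊢; linear_combination hC7
    · intro b d hbd
      refine hk₁ b.val (ZMod.val_lt b) d.val (ZMod.val_lt d) (Int.emod_eq_zero_of_dvd ?_)
      refine (ZMod.intCast_zmod_eq_zero_iff_dvd _ _).mp ?_
      push_cast
      rw [ZMod.natCast_zmod_val, ZMod.natCast_zmod_val]
      linear_combination hbd
    · intro a d had
      refine hk₂ a.val (ZMod.val_lt a) d.val (ZMod.val_lt d) (Int.emod_eq_zero_of_dvd ?_)
      refine (ZMod.intCast_zmod_eq_zero_iff_dvd _ _).mp ?_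
      push_cast
      rw [ZMod.natCast_zmod_val, ZMod.natCast_zmod_val]
      linear_combination had
    · intro a b hab
      refine hk₃ a.val (ZMod.val_lt a) b.val (ZMod.val_lt b) (Int.emod_eq_zero_of_dvd ?_)
      refine (ZMod.intCast_zmod_eq_zero_iff_dvd _ _).mp ?_
      push_cast
      rw [ZMod.natCast_zmod_val, ZMod.natCast_zmod_val]
      linear_combination hab
  -- the image bound
  induction Q with
  | zero =>
    rw [← Affine.Point.zero_def, map_zero]
    refine Finset.mem_image.mpr ⟨0, Finset.mem_filter.mpr ⟨Finset.mem_univ _, fun c hc => ?_⟩, ?_⟩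
    · have hw0 := (hvalid c hc).2.1
      exact ⟨hw0, by rwa [add_zero]⟩
    · simp
  | @some X Y hQ =>
    obtain ⟨w, hw⟩ := hsupp X Y hQ
    have hval : κ' (.some X Y hQ) = Additive.ofMul (cubeClass (ζ ^ ((w).1 : ℕ) * ∏ ℓ : Fin t,
        (((((πs ℓ).1 : 𝓞 K) + ((πs ℓ).2 : ℤ) * hζ.toInteger : 𝓞 K) : K) ^ (((w).2 ℓ : Fin 3) : ℕ)
        * ((((πc ℓ).1 : 𝓞 K) + ((πc ℓ).2 : ℤ) * hζ.toInteger : 𝓞 K) : K) ^ ((3 - (((w).2 ℓ : Fin 3)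
            : ℕ)) % 3)))) := by
      rw [hκ', hw]
    refine Finset.mem_image.mpr ⟨w, Finset.mem_filter.mpr ⟨Finset.mem_univ _, fun c hc => ⟨?_, ?_⟩⟩,
      hval.symm⟩
    · rintro rfl
      exact hkill c hc X Y hQ (hw.trans (congrArg cubeClass (hEK _)))
    · intro hcw
      have hneg : κ' (-(.some X Y hQ)) = Additive.ofMul (cubeClass (ζ ^ (((w + w)).1 : ℕ) * ∏ ℓ
          : Fin t, ((((πs ℓ).1 : K) + ((πs ℓ).2 : K) * ζ) ^ ((((w + w)).2 ℓ : Fin 3) : ℕ)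
        * (((πc ℓ).1 : K) + ((πc ℓ).2 : K) * ζ) ^ ((3 - ((((w + w)).2 ℓ : Fin 3) : ℕ)) % 3)))) := by
        rw [map_neg, hval, hEK, ← ofMul_inv]
        congr 1
        rw [cubeClass_eq_mul_self_of_mul_eq_cube (hE0 (w + w)) (hE0 w) (hcube w)]
        exact inv_eq_of_mul_eq_one_right (CubeUnits.mul_mul_self _)
      rw [Affine.Point.neg_some, hκ', ← hcw] at hneg
      exact hkill c hc X _ ((Affine.nonsingular_neg ..).mpr hQ) (Additive.ofMul.injective hneg)

end Summit.BirchSwinnertonDyer.BirchSwinnertonDyer.Rank2Observatory.ThreeIso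

end
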